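import Literature.Computability.AlgebraicComplexity.KV22PowerSumDeterminantalComplexityProofs

/-!
# Route BarrierLever — Kumar–Volk degree trading for a GENERAL affine determinantal representation
# (support for the `dc ≤ n + k` rung of crux `DefinableDcEquations`, stmt-ValiantsHypothesis-8746)

The tree's `KV22PowerSumDeterminantalComplexityProofs.lean` proves Kumar–Volk's
`dc(Σ xᵢⁿ) ≥ 1.5n - 3` by (i) a normal form for the constant part, (ii) a Schur-complement step
trading the lower-right affine block for degree, (iii) a Laplace expansion along the first row,
and (iv) the width lemma for power sums.  Steps (i)–(iii) hold for ANY affine matrix whose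
constant part has corank exactly one; this file extracts them in that generality (the proofs are
the tree's, with the power sum replaced by `det M`):

* `exists_normalForm_of_rank` — (i): if `rank M(0) = m - 1` then `M` can be replaced by a matrix
  of no larger degree, the SAME determinant, and constant part `diag(0, 1, …, 1)` (Kumar–Volk
  Lemma 5; `exists_mul_mul_eq_lamMatrix`).
* `exists_block_trading` — (ii): for `M` affine in normal form of size `(k'+1) + (s+1)`, a matrix
  `N` of size `k'+1`, degree `≤ s + 2`, in normal form, with `det N = det M · Δ^{k'}`, `Δ(0) = 1`,
  `deg Δ ≤ s + 1` (Kumar–Volk §3.3 with Lemma 10).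
* `exists_first_row_decomposition` — (iii): for `N` of size `m + 1` in normal form with
  `det N = F · (1 + Q)`, `F(0) = Q(0) = 0`: `F = Σ_{o ∈ Option (Fin (m+1))} P_o Q_o + N₀₀` with all
  `P_o, Q_o` constant free (Kumar–Volk Lemma 11, before the width lemma), with degree bounds.
* **`exists_sum_mul_decomposition`** — the three combined: an affine matrix `M` of size
  `(k'+1) + (s+1)` (`k' ≥ 1`) with `det M (0) = 0` and `rank M(0) = size - 1` has
  `det M = Σ_o P_o Q_o + N₀₀`, `2(k'+2)` constant-free factors of degree `≤ (k'+2)(s+3)`,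
  `deg N₀₀ ≤ s + 2`.  Geometrically: `det M - N₀₀ ∈ J²` for an ideal `J` with `2k' + 4` generators
  through the origin — the source of singular points of the top form in `2k' + O(1)` further
  coordinates (next file).

Nothing here bears on `VP` vs `VNP`.  No definitions, no named-fact hypotheses; standard axioms.

References: M. Kumar, B. L. Volk, *A lower bound on determinantal complexity*, comput. complexity
31 (2022) 12 = arXiv:2009.02452, Lemma 5, Lemma 10, Lemma 11, §3.3 [KumarVolk2022b].
-/

-- layout Summits/ValiantsHypothesis/ValiantsHypothesis forces the duplicated namespace component
set_option linter.dupNamespace false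

noncomputable section

open MvPolynomial Matrix Finset

namespace Summit.ValiantsHypothesis.ValiantsHypothesis.Theorems.BarrierLever.DcConstantExcess

open Literature.Computability.AlgebraicComplexity
open Literature.Computability.AlgebraicComplexity.KumarVolk

variable {w : ℕ}

/-! ## §1 Normal form from corank one of the constant part (Kumar–Volk Lemma 5, general) -/

/-- **Normal form.**  If the constant part of a square matrix `M` of polynomials (size `m + 1`)
has rank `m`, then there is `M'` with `deg M' ≤ deg M`, `det M' = det M` and constant part
`diag(0, 1, …, 1)` (`IsNormalForm`): Gaussian elimination `V M(0) U = Λ_{i₀}`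
(`exists_mul_mul_eq_lamMatrix`), a diagonal rescaling restoring the determinant, and conjugation
by the transposition `(0 i₀)` — the tree's proof of Kumar–Volk Lemma 5 with the power sum replaced
by `det M`. [cite: KumarVolk2022b, Lemma 5] -/
theorem exists_normalForm_of_rank {m : ℕ}
    (M : Matrix (Fin (m + 1)) (Fin (m + 1)) (MvPolynomial (Fin w) ℂ))
    (hrank : (constPart M).rank = m) :
    ∃ M' : Matrix (Fin (m + 1)) (Fin (m + 1)) (MvPolynomial (Fin w) ℂ),
      polyDeg M' ≤ polyDeg M ∧ M'.det = M.det ∧ IsNormalForm M' := by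
  classical
  obtain ⟨V, U, i₀, hV, hU, hVU⟩ := exists_mul_mul_eq_lamMatrix (constPart M)
    (by rw [Fintype.card_fin, hrank]; omega) (by rw [Fintype.card_fin]; omega)
  have hVdet : V.det ≠ 0 := ((Matrix.isUnit_iff_isUnit_det V).1 hV).ne_zero
  have hUdet : U.det ≠ 0 := ((Matrix.isUnit_iff_isUnit_det U).1 hU).ne_zero
  set c : ℂ := (V.det * U.det)⁻¹ with hc
  have hcVU : V.det * U.det * c = 1 := mul_inv_cancel₀ (mul_ne_zero hVdet hUdet)
  let δ : Fin (m + 1) → ℂ := Function.update 1 i₀ c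
  let Δ : Matrix (Fin (m + 1)) (Fin (m + 1)) ℂ := Matrix.diagonal δ
  have hΔdet : Δ.det = c := by
    rw [Matrix.det_diagonal, Finset.prod_update_of_mem (Finset.mem_univ _)]
    simp
  have hΛΔ : lamMatrix ℂ i₀ * Δ = lamMatrix ℂ i₀ := by
    rw [lamMatrix, Matrix.diagonal_mul_diagonal]
    congr 1
    funext i
    by_cases hi : i = i₀
    · subst hi; simp
    · simp [δ, Function.update_of_ne hi]
  let Cm : Matrix (Fin (m + 1)) (Fin (m + 1)) ℂ → Matrix (Fin (m + 1)) (Fin (m + 1))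
      (MvPolynomial (Fin w) ℂ) := fun A => A.map (C : ℂ → MvPolynomial (Fin w) ℂ)
  have hCdet : ∀ A : Matrix (Fin (m + 1)) (Fin (m + 1)) ℂ, (Cm A).det = C A.det := by
    intro A
    change ((C : ℂ →+* MvPolynomial (Fin w) ℂ).mapMatrix A).det = _
    rw [← RingHom.map_det]
  let M₁ := Cm V * M * Cm U * Cm Δ
  have hM₁det : M₁.det = M.det := by
    simp only [M₁, Matrix.det_mul, hCdet, hΔdet]
    calc C V.det * M.det * C U.det * C c = M.det * C (V.det * U.det * c) := by
          simp only [C_mul]; ring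
      _ = M.det := by rw [hcVU, C_1, mul_one]
  have hM₁const : constPart M₁ = lamMatrix ℂ i₀ := by
    simp only [M₁, Cm, constPart_mul, constPart_map_C, hVU, hΛΔ]
  have hM₁deg : polyDeg M₁ ≤ polyDeg M :=
    (polyDeg_mulConst_le _ _).trans ((polyDeg_mulConst_le _ _).trans (polyDeg_constMul_le _ _))
  let σ : Equiv.Perm (Fin (m + 1)) := Equiv.swap 0 i₀
  refine ⟨M₁.submatrix σ σ, (polyDeg_submatrix_le _ _ _).trans hM₁deg,
    by rw [Matrix.det_submatrix_equiv_self, hM₁det], ?_⟩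
  rw [isNormalForm_iff_constPart]
  have : constPart (M₁.submatrix σ σ) = (constPart M₁).submatrix σ σ := rfl
  rw [this, hM₁const]
  ext i j
  simp only [Matrix.submatrix_apply, lamMatrix_apply, EmbeddingLike.apply_eq_iff_eq]
  have hσ : σ i = i₀ ↔ i = 0 := by
    rw [Equiv.apply_eq_iff_eq_symm_apply, Equiv.symm_swap, Equiv.swap_apply_right]
  simp only [hσ]

/-! ## §2 Trading the lower-right block for degree (Kumar–Volk §3.3, general) -/

/-- **Degree trading.**  Let `M` be a matrix of affine polynomials in normal form, of size
`(k'+1) + (s+1)`, `k' ≥ 1`.  Split off the lower-right `(s+1) × (s+1)` block `D` (constant part the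
identity) and form `N = det D · A − B · adj D · C` (the Schur complement cleared of denominators,
`M · [[det D · 1, 0], [−adj D · C, 1]] = [[N, B], [0, D]]`): `N` has size `k'+1`, degree `≤ s + 2`,
is in normal form, and `det N = det M · (det D)^{k'}` with `det D (0) = 1`, `deg det D ≤ s + 1`.
The tree's proof of Kumar–Volk Thm. 1 (core), with the power sum replaced by `det M`.
[cite: KumarVolk2022b, Thm. 1 (proof, §3.3) and Lemma 10] -/
theorem exists_block_trading {s k' : ℕ}
    (M : Matrix (Fin ((k' + 1) + (s + 1))) (Fin ((k' + 1) + (s + 1))) (MvPolynomial (Fin w) ℂ))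
    (hMdeg : polyDeg M ≤ 1) (hMnf : IsNormalForm M) :
    ∃ (N : Matrix (Fin (k' + 1)) (Fin (k' + 1)) (MvPolynomial (Fin w) ℂ)) (Δ : MvPolynomial (Fin w) ℂ),
      polyDeg N ≤ s + 2 ∧ IsNormalForm N ∧ constantCoeff Δ = 1 ∧ Δ.totalDegree ≤ s + 1 ∧
        N.det = M.det * Δ ^ k' := by
  classical
  -- block decomposition along `Fin (k'+1) ⊕ Fin (s+1) ≃ Fin ((k'+1) + (s+1))`
  let e : Fin (k' + 1) ⊕ Fin (s + 1) ≃ Fin ((k' + 1) + (s + 1)) := finSumFinEquiv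
  let Ms : Matrix (Fin (k' + 1) ⊕ Fin (s + 1)) (Fin (k' + 1) ⊕ Fin (s + 1)) (MvPolynomial (Fin w) ℂ) :=
    M.submatrix e e
  let A : Matrix (Fin (k' + 1)) (Fin (k' + 1)) (MvPolynomial (Fin w) ℂ) := Ms.toBlocks₁₁
  let B : Matrix (Fin (k' + 1)) (Fin (s + 1)) (MvPolynomial (Fin w) ℂ) := Ms.toBlocks₁₂
  let C' : Matrix (Fin (s + 1)) (Fin (k' + 1)) (MvPolynomial (Fin w) ℂ) := Ms.toBlocks₂₁
  let D : Matrix (Fin (s + 1)) (Fin (s + 1)) (MvPolynomial (Fin w) ℂ) := Ms.toBlocks₂₂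
  have hMs : Matrix.fromBlocks A B C' D = Ms := Matrix.fromBlocks_toBlocks Ms
  have hMsdet : Ms.det = M.det := by rw [Matrix.det_submatrix_equiv_self]
  have he_inl : ∀ i : Fin (k' + 1), ((e (Sum.inl i) : Fin ((k' + 1) + (s + 1))) : ℕ) = i :=
    fun i => by simp [e, finSumFinEquiv_apply_left]
  have he_inr : ∀ i : Fin (s + 1), ((e (Sum.inr i) : Fin ((k' + 1) + (s + 1))) : ℕ) = (k' + 1) + i :=
    fun i => by simp [e, finSumFinEquiv_apply_right]
  have hMs_cc : ∀ a b, constantCoeff (Ms a b) =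
      if a = b ∧ ((e a : Fin ((k' + 1) + (s + 1))) : ℕ) ≠ 0 then 1 else 0 := by
    intro a b
    change constantCoeff (M (e a) (e b)) = _
    rw [hMnf]
    simp only [EmbeddingLike.apply_eq_iff_eq]
  have hMs_deg : ∀ a b, (Ms a b).totalDegree ≤ 1 := fun a b =>
    (totalDegree_le_polyDeg M _ _).trans hMdeg
  have hA : IsNormalForm A := by
    intro i j
    change constantCoeff (Ms (Sum.inl i) (Sum.inl j)) = _
    rw [hMs_cc]
    simp only [Sum.inl.injEq, he_inl]
  have hC0 : ∀ l j, constantCoeff (C' l j) = 0 := fun l j => by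
    change constantCoeff (Ms (Sum.inr l) (Sum.inl j)) = 0
    rw [hMs_cc]; simp
  have hDcp : constPart D = 1 := by
    ext i j
    rw [constPart_apply]
    change constantCoeff (Ms (Sum.inr i) (Sum.inr j)) = _
    rw [hMs_cc, Matrix.one_apply]
    have hne : ((e (Sum.inr i) : Fin ((k' + 1) + (s + 1))) : ℕ) ≠ 0 := by rw [he_inr]; omega
    by_cases hij : i = j
    · subst hij; rw [if_pos ⟨rfl, hne⟩, if_pos rfl]
    · rw [if_neg (fun h => hij (Sum.inr_injective h.1)), if_neg hij]
  have hDcc : constantCoeff D.det = 1 := by rw [← det_constPart, hDcp, Matrix.det_one]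
  have hD0 : D.det ≠ 0 := fun h => by rw [h, map_zero] at hDcc; exact zero_ne_one hDcc
  let N : Matrix (Fin (k' + 1)) (Fin (k' + 1)) (MvPolynomial (Fin w) ℂ) :=
    D.det • A - B * D.adjugate * C'
  have hblock : Matrix.fromBlocks A B C' D *
      Matrix.fromBlocks (D.det • (1 : Matrix (Fin (k' + 1)) (Fin (k' + 1)) (MvPolynomial (Fin w) ℂ)))
        0 (-(D.adjugate * C')) 1 = Matrix.fromBlocks N B 0 D := by
    rw [Matrix.fromBlocks_multiply, Matrix.fromBlocks_inj]
    refine ⟨?_, ?_, ?_, ?_⟩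
    · rw [Matrix.mul_smul, Matrix.mul_one, Matrix.mul_neg, ← Matrix.mul_assoc, ← sub_eq_add_neg]
    · rw [Matrix.mul_zero, zero_add, Matrix.mul_one]
    · rw [Matrix.mul_smul, Matrix.mul_one, Matrix.mul_neg, ← Matrix.mul_assoc, Matrix.mul_adjugate,
        Matrix.smul_mul, Matrix.one_mul, add_neg_cancel]
    · rw [Matrix.mul_zero, zero_add, Matrix.mul_one]
  have hdet_eq : M.det * D.det ^ (k' + 1) = N.det * D.det := by
    have h := congrArg Matrix.det hblock
    rwa [Matrix.det_mul, hMs, hMsdet, Matrix.det_fromBlocks_zero₁₂, Matrix.det_smul, Matrix.det_one,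
      mul_one, Fintype.card_fin, Matrix.det_one, mul_one, Matrix.det_fromBlocks_zero₂₁] at h
  have hNdet : N.det = M.det * D.det ^ k' := by
    apply mul_right_cancel₀ hD0
    rw [← hdet_eq, pow_succ, mul_assoc]
  have hNnf : IsNormalForm N := by
    intro i j
    simp only [N, Matrix.sub_apply, Matrix.smul_apply, smul_eq_mul, map_sub, map_mul, hDcc, one_mul,
      Matrix.mul_apply, map_sum, hC0, mul_zero, Finset.sum_const_zero, sub_zero]
    exact hA i j
  have hDdeg : D.det.totalDegree ≤ s + 1 := by
    have h1 := totalDegree_det_le D (e := 1) fun a b => hMs_deg _ _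
    rw [Fintype.card_fin] at h1
    omega
  have hNdeg : polyDeg N ≤ s + 2 := by
    rw [polyDeg_le_iff]
    intro i j
    simp only [N, Matrix.sub_apply, Matrix.smul_apply, smul_eq_mul]
    refine (totalDegree_sub _ _).trans (max_le ?_ ?_)
    · refine (totalDegree_mul _ _).trans ?_
      have h2 : (A i j).totalDegree ≤ 1 := hMs_deg _ _
      omega
    · rw [Matrix.mul_apply]
      refine totalDegree_finsetSum_le fun l _ => ?_
      rw [Matrix.mul_apply, Finset.sum_mul]
      refine totalDegree_finsetSum_le fun p _ => ?_
      refine (totalDegree_mul _ _).trans ((add_le_add (totalDegree_mul _ _) le_rfl).trans ?_)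
      have h1 : (B i p).totalDegree ≤ 1 := hMs_deg _ _
      have h2 := totalDegree_adjugate_le D (e := 1) (fun a b => hMs_deg _ _) p l
      have h3 : (C' l j).totalDegree ≤ 1 := hMs_deg _ _
      omega
  exact ⟨N, D.det, hNdeg, hNnf, hDcc, hDdeg, hNdet⟩

/-! ## §3 Laplace expansion along the first row (Kumar–Volk Lemma 11, general) -/

/-- **First-row decomposition.**  Let `N` be a matrix of polynomials of size `m + 1`, degree
`≤ e`, in normal form, with `det N = F · (1 + Q)` where `F(0) = Q(0) = 0`.  Then
`F = Σ_{o ∈ Option (Fin (m+1))} P_o Q_o + N₀₀`, all `P_o, Q_o` constant free, of degrees bounded by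
`max (deg F, e)` and `max (deg Q, m e)` respectively: Laplace expansion of `det N` along the first
row (its entries are constant free; `det N_{1,1} = 1 + P`, the other minors are constant free), the
tree's proof of Kumar–Volk Lemma 11 stopped before the width lemma, with the power sum replaced by
`F`. [cite: KumarVolk2022b, Lemma 11] -/
theorem exists_first_row_decomposition {m e E : ℕ}
    (N : Matrix (Fin (m + 1)) (Fin (m + 1)) (MvPolynomial (Fin w) ℂ)) (hdeg : polyDeg N ≤ e)
    (hnf : IsNormalForm N) (F Q : MvPolynomial (Fin w) ℂ) (hF0 : constantCoeff F = 0)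
    (hQ : constantCoeff Q = 0) (hdet : N.det = F * (1 + Q))
    (hFE : F.totalDegree ≤ E) (heE : e ≤ E) (hQE : Q.totalDegree ≤ E) (hmE : m * e ≤ E) :
    ∃ P Qq : Option (Fin (m + 1)) → MvPolynomial (Fin w) ℂ,
      (∀ o, constantCoeff (P o) = 0) ∧ (∀ o, constantCoeff (Qq o) = 0) ∧
      (∀ o, (P o).totalDegree ≤ E) ∧ (∀ o, (Qq o).totalDegree ≤ E) ∧
      (N 0 0).totalDegree ≤ e ∧ F = ∑ o, P o * Qq o + N 0 0 := by
  classical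
  have hL := Matrix.det_succ_row_zero N
  set Nm : Fin (m + 1) → Matrix (Fin m) (Fin m) (MvPolynomial (Fin w) ℂ) :=
    fun j => N.submatrix Fin.succ j.succAbove with hNm
  set c : Fin (m + 1) → ℂ := fun j => constantCoeff (Nm j).det with hc
  have hc' : ∀ j, c j = if j = 0 then 1 else 0 := by
    intro j
    split_ifs with hj
    · subst hj; exact hnf.constantCoeff_det_minor_zero
    · exact hnf.constantCoeff_det_minor_ne_zero hj
  have hsumc : ∑ j : Fin (m + 1), (-1 : MvPolynomial (Fin w) ℂ) ^ (j : ℕ) * N 0 j * C (c j) =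
      N 0 0 := by
    rw [Finset.sum_eq_single (0 : Fin (m + 1))]
    · rw [hc', if_pos rfl, C_1, mul_one, Fin.val_zero, pow_zero, one_mul]
    · intro j _ hj; rw [hc', if_neg hj, C_0, mul_zero]
    · intro h; exact absurd (Finset.mem_univ _) h
  let P : Option (Fin (m + 1)) → MvPolynomial (Fin w) ℂ := fun o =>
    o.elim F fun j => (-1) ^ (j : ℕ) * N 0 j
  let Qq : Option (Fin (m + 1)) → MvPolynomial (Fin w) ℂ := fun o =>
    o.elim (-Q) fun j => (Nm j).det - C (c j)
  have hS : ∑ j : Fin (m + 1), P (some j) * Qq (some j) = N.det - N 0 0 := by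
    rw [hL, ← hsumc, ← Finset.sum_sub_distrib]
    refine Finset.sum_congr rfl fun j _ => ?_
    simp only [P, Qq, Option.elim, hNm]
    ring
  have hid : F = ∑ o, P o * Qq o + N 0 0 := by
    rw [Fintype.sum_option, hS]
    simp only [P, Qq, Option.elim]
    linear_combination (-1 : MvPolynomial (Fin w) ℂ) * hdet
  refine ⟨P, Qq, ?_, ?_, ?_, ?_, (totalDegree_le_polyDeg N 0 0).trans hdeg, hid⟩
  · intro o
    cases o with
    | none => exact hF0
    | some j =>
      simp only [P, Option.elim, map_mul, hnf.constantCoeff_row_zero j, mul_zero]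
  · intro o
    cases o with
    | none => simp only [Qq, Option.elim, map_neg, hQ, neg_zero]
    | some j => simp only [Qq, Option.elim, map_sub, constantCoeff_C, hc, sub_self]
  · intro o
    cases o with
    | none => exact hFE
    | some j =>
      simp only [P, Option.elim]
      refine (totalDegree_mul _ _).trans ?_
      have h1 : ((-1 : MvPolynomial (Fin w) ℂ) ^ (j : ℕ)).totalDegree = 0 := by
        refine Nat.eq_zero_of_le_zero ((totalDegree_pow _ _).trans ?_)
        rw [totalDegree_neg, totalDegree_one, mul_zero]
      have h2 := (totalDegree_le_polyDeg N 0 j).trans hdeg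
      omega
  · intro o
    cases o with
    | none => simp only [Qq, Option.elim, totalDegree_neg]; exact hQE
    | some j =>
      simp only [Qq, Option.elim]
      refine (totalDegree_sub _ _).trans (max_le ?_ ?_)
      · have h := totalDegree_det_le (Nm j) (e := e) fun a b => by
          simp only [hNm, Matrix.submatrix_apply]
          exact (totalDegree_le_polyDeg N _ _).trans hdeg
        rw [Fintype.card_fin] at h
        exact h.trans hmE
      · rw [totalDegree_C]; exact Nat.zero_le _

/-! ## §4 The three steps combined -/

/-- **Kumar–Volk decomposition for a general affine determinantal representation.**  Let `M` be an
affine matrix of size `(k'+1) + (s+1)` (`k' ≥ 1`) with `det M` vanishing at the origin and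
`rank M(0) = size - 1`.  Then `det M = Σ_{o ∈ Option (Fin (k'+1))} P_o Q_o + N₀₀` with all
`2(k'+2)` factors `P_o, Q_o` constant free of degree `≤ (k'+2)(s+3)` and `deg N₀₀ ≤ s + 2`
(so `det M − N₀₀` lies in the square of an ideal with `2k'+4` generators through `0`, while
`deg N₀₀ <` the size `k'+s+2 ≥` any degree-`n = s+3` top form in play).
[cite: KumarVolk2022b, Lemma 5, Lemma 11 and §3.3] -/
theorem exists_sum_mul_decomposition {s k' : ℕ} (hk : 1 ≤ k')
    (M : Matrix (Fin ((k' + 1) + (s + 1))) (Fin ((k' + 1) + (s + 1))) (MvPolynomial (Fin w) ℂ))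
    (hM : ∀ i j, (M i j).totalDegree ≤ 1) (h0 : constantCoeff M.det = 0)
    (hrank : (constPart M).rank = k' + (s + 1)) :
    ∃ (P Qq : Option (Fin (k' + 1)) → MvPolynomial (Fin w) ℂ) (N₀₀ : MvPolynomial (Fin w) ℂ),
      (∀ o, constantCoeff (P o) = 0) ∧ (∀ o, constantCoeff (Qq o) = 0) ∧
      (∀ o, (P o).totalDegree ≤ (k' + 2) * (s + 3)) ∧ (∀ o, (Qq o).totalDegree ≤ (k' + 2) * (s + 3)) ∧
      N₀₀.totalDegree ≤ s + 2 ∧ M.det = ∑ o, P o * Qq o + N₀₀ := by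
  classical
  -- (i) normal form
  have hsz : (k' + 1) + (s + 1) = (k' + s + 1) + 1 := by omega
  obtain ⟨M', hM'deg, hM'det, hM'nf⟩ := exists_normalForm_of_rank (m := k' + (s + 1))
    (M.submatrix (Fin.cast (by omega)) (Fin.cast (by omega))) (by
      have : constPart (M.submatrix (Fin.cast (by omega : k' + (s + 1) + 1 = (k' + 1) + (s + 1)))
          (Fin.cast (by omega))) = (constPart M).submatrix (Fin.cast (by omega)) (Fin.cast (by omega)) := rfl
      rw [this]
      rw [show (Fin.cast (by omega : k' + (s + 1) + 1 = (k' + 1) + (s + 1)) : Fin (k' + (s + 1) + 1) →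
          Fin ((k' + 1) + (s + 1))) = ⇑(finCongr (by omega : k' + (s + 1) + 1 = (k' + 1) + (s + 1)))
          from rfl, Matrix.rank_submatrix]
      exact hrank)
  -- transport `M'` back to the block shape
  let M'' : Matrix (Fin ((k' + 1) + (s + 1))) (Fin ((k' + 1) + (s + 1))) (MvPolynomial (Fin w) ℂ) :=
    M'.submatrix (Fin.cast (by omega)) (Fin.cast (by omega))
  have hM''det : M''.det = M.det := by
    have h1 : M''.det = M'.det := by
      rw [show M'' = M'.submatrix ⇑(finCongr (by omega : (k' + 1) + (s + 1) = k' + (s + 1) + 1))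
        ⇑(finCongr (by omega)) from rfl, Matrix.det_submatrix_equiv_self]
    have h2 : (M.submatrix (Fin.cast (by omega : k' + (s + 1) + 1 = (k' + 1) + (s + 1)))
        (Fin.cast (by omega))).det = M.det := by
      rw [show (M.submatrix (Fin.cast (by omega : k' + (s + 1) + 1 = (k' + 1) + (s + 1)))
        (Fin.cast (by omega))) = M.submatrix ⇑(finCongr (by omega : k' + (s + 1) + 1 = (k' + 1) + (s + 1)))
        ⇑(finCongr (by omega)) from rfl, Matrix.det_submatrix_equiv_self]
    rw [h1, hM'det, h2]
  have hM''deg : polyDeg M'' ≤ 1 :=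
    (polyDeg_submatrix_le _ _ _).trans (hM'deg.trans ((polyDeg_submatrix_le _ _ _).trans
      ((polyDeg_le_iff M 1).2 hM)))
  have hM''nf : IsNormalForm M'' := by
    intro i j
    change constantCoeff (M' (Fin.cast _ i) (Fin.cast _ j)) = _
    rw [hM'nf]
    simp only [Fin.cast_inj, Fin.val_cast]
  -- (ii) degree trading
  obtain ⟨N, Δ, hNdeg, hNnf, hΔ0, hΔdeg, hNdet⟩ := exists_block_trading M'' hM''deg hM''nf
  rw [hM''det] at hNdet
  -- (iii) first-row decomposition with `F = det M`, `1 + Q = Δ^k'`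
  have hQ0 : constantCoeff (Δ ^ k' - 1) = 0 := by rw [map_sub, map_pow, hΔ0, one_pow, map_one, sub_self]
  have hdet' : N.det = M.det * (1 + (Δ ^ k' - 1)) := by rw [hNdet, add_sub_cancel]
  have hFdeg : M.det.totalDegree ≤ (k' + 2) * (s + 3) := by
    have h := totalDegree_det_le M (e := 1) hM
    rw [Fintype.card_fin] at h
    nlinarith
  have hQdeg : (Δ ^ k' - 1 : MvPolynomial (Fin w) ℂ).totalDegree ≤ (k' + 2) * (s + 3) := by
    refine (totalDegree_sub _ _).trans (max_le ?_ ?_)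
    · refine (totalDegree_pow _ _).trans ?_
      calc k' * Δ.totalDegree ≤ k' * (s + 1) := Nat.mul_le_mul_left _ hΔdeg
        _ ≤ (k' + 2) * (s + 3) := by nlinarith
    · rw [totalDegree_one]; exact Nat.zero_le _
  obtain ⟨P, Qq, hP0, hQq0, hPdeg, hQqdeg, hN00, hid⟩ :=
    exists_first_row_decomposition N hNdeg hNnf M.det (Δ ^ k' - 1) h0 hQ0 hdet' hFdeg
      (by nlinarith) hQdeg (by nlinarith)
  exact ⟨P, Qq, N 0 0, hP0, hQq0, hPdeg, hQqdeg, hN00, hid⟩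

end Summit.ValiantsHypothesis.ValiantsHypothesis.Theorems.BarrierLever.DcConstantExcess

end
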